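import Summits.QuantumFields.BalabanUV.T4Continuum.Support.NE9Lemma1RemainderPiece

/-!
# NE9RemainderPieceCoupling — leaf A3's PER-PIECE COUPLING-RESPONSE bound for the DISPLAYED SPECIES at FORM level: the
directional Taylor remainder is LIPSCHITZ IN THE DIRECTION with the gain kept, and the (1.23)-functional of the remainder
DIFFERENCE obeys the (1.24) shape (cell `pub-balaban`, T4-DAG §2 node U3 ∕ §6 NE9; NE9 formalisation swarm, unit
`b2b-balaban-t4-ne9-formalise-leaf-03` gen 3; the owner's pointer CLAIMS.log l.7970 «your A3-eval per-piece coupling modulus for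
the displayed species is `norm_remPiece_le` applied at two couplings once the direction map's s-dependence is typed — the
Newton–Taylor∕Schwarz engine `norm_dirRem_le` is reusable BY NAME»; companion of `NE9PieceCouplingModulus` p211558 whose
displayed binder `hresp` this file produces for the displayed species)

HONEST FRAMING (T4-DAG PAGE 1).  Rung (B)+1 on a FIXED finite torus — NOT infinite volume, NOT a mass gap, NOT the Clay
problem.  NE9 is a cell NEW ESTIMATE, NOT PRINTED, NOT discharged here.  Pure complex analysis on an abstract complex normed
configuration space `E` and the row owner's FORM-level objects `NE9Lemma1RemainderPiece.taylorRem` ∕ `dirRem` ∕ the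
(1.23)-functional (`B13Sect1Arith.cauchyOp`); [I] = [Balaban1987RG1], [II] = [Balaban1988RG2Cluster] quoted for TYPES only
(ABSOLUTE RULE).  No Prop-valued definition; `FlowStep.BetaPertH`, (B), (B^μ) do not occur.

WHERE THIS SITS.  `NE9PieceCouplingModulus.channelCouplingModulus_piece` (p211558) derives the END's `hTcup` on the owner's piece
form from ONE displayed per-piece COUPLING-RESPONSE bound `|piece(k,g,…)(f) − piece(k,g′,…)(f)| ≤ Kp·qc·gain·(…)·|g k − g′ k|`.
For the DISPLAYED species — the fifth-order remainder piece of [I] (3.34)∕[II] (1.23), typed by the owner as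
`remPiece ρ r l H n A s σ = (2πi)⁻¹∮_{|t|=r} dt∕t² · cauchyOp ρ l (s′ σ′ ↦ dirRem H n (A t s′ σ′)) s σ` with
`dirRem H n A = R_n[τ ↦ H(τ•A)](1)` and SIZE bound `norm_dirRem_le : ‖dirRem H n A‖ ≤ 2ⁿ·M·(a∕R)ⁿ` — the coupling `s` enters
through the DIRECTION MAP `A` (the shift function 𝐇_k(s): [I] (2.12) p. 268, [II] (1.21)–(1.23) p. 7).  THIS FILE proves the
coupling twin of the owner's engine: (§1) the Taylor remainder and the divided-slope tails are ADDITIVE in the function on a disc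
of analyticity; (§2) an analytic `H` bounded by `M` on `‖z‖ < R` is `2M∕(R − ρ₀)`-Lipschitz on `‖z‖ ≤ ρ₀ < R` (one-variable Cauchy
estimate on complex lines + the real mean-value inequality); (§3) hence for two directions of norm `≤ a` with `0 < a < R′ < R`,
**`‖dirRem H n A − dirRem H n A′‖ ≤ 2ⁿ·(2M·(R′∕a)·‖A − A′‖∕(R − R′))·(a∕R′)ⁿ`** = `2^{n+1}·M·(a∕R′)^{n−1}·‖A − A′‖∕(R − R′)` — the
gain `(a∕R′)^{n−1}` KEPT (the difference of the two slices `τ ↦ H(τ•A) − H(τ•A′)` is itself an analytic slice of sup `∝ ‖A − A′‖`, to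
which the owner's `norm_taylorRem_le` applies); (§4) the (1.23)-functional of the remainder DIFFERENCE obeys
`B13Sect1Arith.bound_124` with that constant: `≤ (1∕r)·(2ⁿ·(2M(R′∕a)δ∕(R − R′))·(a∕R′)ⁿ)·exp(−(κ₁−1)·#cubes)` when the two direction
maps differ by at most `δ` on the contours — for direction maps `δ ≤ a₁·|s − s′|` apart (the shift is Lipschitz in the
amplitude — TYPE (1.21): «|𝐇_k(s(Y₀), B′)| ≦ 4B₀C₁e^{16κ₁}g_k|B|», displayed, not asserted) this IS the `hresp` shape of p211558
with `gain = (a∕R′)^{n−1}·(a₁∕(R−R′))`-type letters.  NOT PRINTED and not claimed: the equality of §4's functional with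
`remPiece(A) − remPiece(A′)` (linearity of INTEGRABLE contour integrals — instantiation-side, as in the owner's module); the
domain inclusions `a < R′ < R` ((I.3.36)–(3.53) TYPE statements); anything about Bałaban's 𝐇_k.  DISGUISE TEST: one term `H`, one
polymer functional, two DIRECTIONS — no history, no renormalised term; not NE9.

WHAT IS PROVED (kernel, `[folklore]`; 0 sorry, 0 `def`).
§1 `dslope_sub_of_differentiableAt`, `tail_sub`, `taylorRem_sub`.
§2 `norm_segment_le`, **`norm_sub_le_of_ball`** (Lipschitz bound of a bounded analytic map on a smaller ball).
§3 **`norm_dirRem_sub_dirRem_le`** (+ `…_five` spelled out: factor 64·M·(a∕R′)⁴·‖A−A′‖·(1∕(R−R′))·… see statement).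
§4 **`norm_remPieceDiff_le`** (the (1.23)-functional of the remainder difference, `bound_124` with its hypothesis discharged by §3).

References (TYPES only): [Balaban1987RG1] CMP 109 (1987) (3.34)–(3.36) p. 277, (3.54) p. 280, (2.12) p. 268; [Balaban1988RG2Cluster]
CMP 116 (1988) (1.21)–(1.24) p. 7.
-/

noncomputable section

namespace Summit.QuantumFields.BalabanUV.T4Continuum.NE9RemainderPieceCoupling

open scoped BigOperators
open Metric Set Complex
open Literature.MathematicalPhysics.QuantumFieldTheory.Balaban1983to89
open Literature.MathematicalPhysics.QuantumFieldTheory.Balaban1983to89.B11SchwarzRemainder (tail tail_zero tail_succ tail_succ')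
open Summit.QuantumFields.BalabanUV.T4Continuum.NE9Lemma1RemainderPiece

variable {F : Type*} [NormedAddCommGroup F] [NormedSpace ℂ F]

/-! ## §1 Additivity of divided-slope tails and of the Taylor remainder on a disc of analyticity -/

/-- `dslope` at `0` is additive in the function when both functions are differentiable at `0` (off `0` it is the slope,
linear unconditionally; at `0` it is the derivative). [folklore] -/
theorem dslope_sub_of_differentiableAt {f g : ℂ → F} (hf : DifferentiableAt ℂ f 0) (hg : DifferentiableAt ℂ g 0) :
    dslope (f - g) 0 = dslope f 0 - dslope g 0 := by
  funext b
  by_cases hb : b = 0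
  · subst hb
    rw [Pi.sub_apply, dslope_same, dslope_same, dslope_same]
    exact deriv_sub hf hg
  · rw [Pi.sub_apply, dslope_of_ne _ hb, dslope_of_ne _ hb, dslope_of_ne _ hb, slope_def_module, slope_def_module,
      slope_def_module, ← smul_sub]
    congr 1
    simp only [Pi.sub_apply]
    abel

section Complete

variable [CompleteSpace F]

/-- The iterated divided slopes at `0` are additive in the function for functions analytic on a disc about `0`. [folklore] -/
theorem tail_sub {r : ℝ} (hr : 0 < r) :
    ∀ (k : ℕ) (f g : ℂ → F), DifferentiableOn ℂ f (ball 0 r) → DifferentiableOn ℂ g (ball 0 r) →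
      tail (f - g) k = tail f k - tail g k := by
  intro k
  induction k with
  | zero => intro f g _ _; rfl
  | succ k ih =>
    intro f g hf hg
    have hball : ball (0 : ℂ) r ∈ nhds (0 : ℂ) := ball_mem_nhds 0 hr
    have hf0 : DifferentiableAt ℂ f 0 := hf.differentiableAt hball
    have hg0 : DifferentiableAt ℂ g 0 := hg.differentiableAt hball
    rw [tail_succ', tail_succ', tail_succ', dslope_sub_of_differentiableAt hf0 hg0]
    exact ih _ _ ((differentiableOn_dslope hball).2 hf) ((differentiableOn_dslope hball).2 hg)

/-- The Taylor remainder at `0` is additive in the function for functions analytic on a disc about `0`. [folklore] -/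
theorem taylorRem_sub {r : ℝ} (hr : 0 < r) {f g : ℂ → F} (hf : DifferentiableOn ℂ f (ball 0 r))
    (hg : DifferentiableOn ℂ g (ball 0 r)) (n : ℕ) (t : ℂ) :
    taylorRem (f - g) n t = taylorRem f n t - taylorRem g n t := by
  rw [taylorRem_eq, taylorRem_eq, taylorRem_eq, tail_sub hr n f g hf hg, Pi.sub_apply, smul_sub]

end Complete

/-! ## §2 A bounded analytic map is Lipschitz on a smaller ball (Cauchy estimate on complex lines + real mean value) -/

section Lipschitz

variable {E : Type*} [NormedAddCommGroup E] [NormedSpace ℂ E] [CompleteSpace F]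

/-- A point of the real segment between two points of the closed ball of radius `ρ₀` lies in that ball. [folklore] -/
theorem norm_segment_le {Z Z' : E} {ρ₀ : ℝ} (hZ : ‖Z‖ ≤ ρ₀) (hZ' : ‖Z'‖ ≤ ρ₀) {x : ℝ} (hx : x ∈ Icc (0 : ℝ) 1) :
    ‖Z' + (x : ℂ) • (Z - Z')‖ ≤ ρ₀ := by
  have hx0 : 0 ≤ x := hx.1
  have hx1 : x ≤ 1 := hx.2
  have hrw : Z' + (x : ℂ) • (Z - Z') = ((1 - x : ℝ) : ℂ) • Z' + (x : ℂ) • Z := by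
    push_cast
    simp only [sub_smul, one_smul, smul_sub]
    abel
  rw [hrw]
  calc ‖((1 - x : ℝ) : ℂ) • Z' + (x : ℂ) • Z‖ ≤ ‖((1 - x : ℝ) : ℂ) • Z'‖ + ‖(x : ℂ) • Z‖ := norm_add_le _ _
    _ = (1 - x) * ‖Z'‖ + x * ‖Z‖ := by
        rw [norm_smul, norm_smul, Complex.norm_real, Complex.norm_real, Real.norm_eq_abs, Real.norm_eq_abs,
          abs_of_nonneg (by linarith), abs_of_nonneg hx0]
    _ ≤ (1 - x) * ρ₀ + x * ρ₀ :=
        add_le_add (mul_le_mul_of_nonneg_left hZ' (by linarith)) (mul_le_mul_of_nonneg_left hZ hx0)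
    _ = ρ₀ := by ring

omit [CompleteSpace F] in
/-- **LIPSCHITZ BOUND OF A BOUNDED ANALYTIC MAP ON A SMALLER BALL (kernel).**  `H : E → F` complex-differentiable on
`‖z‖ < R` with `‖H z‖ ≤ M` there; then for `‖Z‖, ‖Z′‖ ≤ ρ₀ < R`: `‖H Z − H Z′‖ ≤ (2M∕(R − ρ₀))·‖Z − Z′‖`.  (The factor 2:
the one-variable Cauchy estimate is taken on discs of HALF the available radius; print's O(1).)  Proof: along the complex line
`μ ↦ H(Z′ + μ(Z − Z′))` the derivative at real `μ ∈ [0,1]` is `≤ M∕radius` (Mathlib `Complex.norm_deriv_le_of_forall_mem_sphere_norm_le`),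
then the real mean-value inequality on `[0,1]`. [folklore] -/
theorem norm_sub_le_of_ball {H : E → F} {R M ρ₀ : ℝ} (hH : DifferentiableOn ℂ H (ball 0 R))
    (hM : ∀ z ∈ ball (0 : E) R, ‖H z‖ ≤ M) (hρ : ρ₀ < R) {Z Z' : E} (hZ : ‖Z‖ ≤ ρ₀) (hZ' : ‖Z'‖ ≤ ρ₀) :
    ‖H Z - H Z'‖ ≤ 2 * M / (R - ρ₀) * ‖Z - Z'‖ := by
  have hR : 0 < R := lt_of_le_of_lt ((norm_nonneg Z).trans hZ) hρ
  have hM0 : 0 ≤ M := (norm_nonneg _).trans (hM 0 (mem_ball_self hR))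
  have hgap : 0 < R - ρ₀ := sub_pos.mpr hρ
  set D : E := Z - Z' with hD
  by_cases hD0 : D = 0
  · have hZZ : Z = Z' := sub_eq_zero.mp (by rw [← hD]; exact hD0)
    rw [hZZ, sub_self, norm_zero, hD0, norm_zero, mul_zero]
  have hDn : 0 < ‖D‖ := norm_pos_iff.mpr hD0
  -- the complex line through Z' in the direction D
  set h : ℂ → F := fun μ => H (Z' + μ • D) with hh
  have hlin : Differentiable ℂ (fun μ : ℂ => Z' + μ • D) := (differentiable_id.smul_const D).const_add Z'
  -- radius of the Cauchy discs about real points of [0,1]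
  set ρ₁ : ℝ := (R - ρ₀) / (2 * ‖D‖) with hρ₁
  have hρ₁0 : 0 < ρ₁ := by rw [hρ₁]; positivity
  -- the derivative bound at every real point of [0,1]
  have hder : ∀ x ∈ Icc (0 : ℝ) 1, HasDerivAt h (deriv h (x : ℂ)) (x : ℂ) ∧ ‖deriv h (x : ℂ)‖ ≤ M / ρ₁ := by
    intro x hx
    have hcentre : ‖Z' + (x : ℂ) • D‖ ≤ ρ₀ := norm_segment_le hZ hZ' hx
    -- h is differentiable on the disc of radius 2ρ₁ about x: it stays inside ‖z‖ < R
    have hmaps : MapsTo (fun μ : ℂ => Z' + μ • D) (ball (x : ℂ) (2 * ρ₁)) (ball (0 : E) R) := by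
      intro μ hμ
      rw [mem_ball, dist_eq_norm] at hμ
      rw [mem_ball_zero_iff]
      have hsplit : Z' + μ • D = (Z' + (x : ℂ) • D) + (μ - (x : ℂ)) • D := by
        simp only [sub_smul]; abel
      have h2ρ : 2 * ρ₁ * ‖D‖ = R - ρ₀ := by
        rw [hρ₁]; field_simp
      calc ‖Z' + μ • D‖ = ‖(Z' + (x : ℂ) • D) + (μ - (x : ℂ)) • D‖ := by rw [hsplit]
        _ ≤ ‖Z' + (x : ℂ) • D‖ + ‖(μ - (x : ℂ)) • D‖ := norm_add_le _ _
        _ = ‖Z' + (x : ℂ) • D‖ + ‖μ - (x : ℂ)‖ * ‖D‖ := by rw [norm_smul]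
        _ < ρ₀ + 2 * ρ₁ * ‖D‖ := by
            have : ‖μ - (x : ℂ)‖ * ‖D‖ < 2 * ρ₁ * ‖D‖ := mul_lt_mul_of_pos_right hμ hDn
            linarith
        _ = R := by rw [h2ρ]; ring
    have hdiff : DifferentiableOn ℂ h (ball (x : ℂ) (2 * ρ₁)) := hH.comp hlin.differentiableOn hmaps
    have hdc : DiffContOnCl ℂ h (ball (x : ℂ) ρ₁) := by
      refine DifferentiableOn.diffContOnCl (hdiff.mono ?_)
      rw [closure_ball _ hρ₁0.ne']
      exact closedBall_subset_ball (by linarith)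
    have hsph : ∀ μ ∈ sphere (x : ℂ) ρ₁, ‖h μ‖ ≤ M := by
      intro μ hμ
      refine hM _ (hmaps ?_)
      rw [mem_sphere] at hμ
      rw [mem_ball, hμ]
      linarith
    refine ⟨(hdiff.differentiableAt (ball_mem_nhds _ (by positivity))).hasDerivAt, ?_⟩
    exact Complex.norm_deriv_le_of_forall_mem_sphere_norm_le hρ₁0 hdc hsph
  -- the mean value inequality on the segment [0,1] ⊂ ℂ (every point of it is a real point of [0,1])
  have hseg : ∀ μ ∈ segment ℝ (0 : ℂ) 1, ∃ x ∈ Icc (0 : ℝ) 1, μ = (x : ℂ) := by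
    intro μ hμ
    rw [segment_eq_image] at hμ
    obtain ⟨x, hx, rfl⟩ := hμ
    refine ⟨x, hx, ?_⟩
    simp only [smul_zero, zero_add, Complex.real_smul, mul_one]
  have hMVT := (convex_segment (0 : ℂ) 1).norm_image_sub_le_of_norm_hasDerivWithin_le
    (f := h) (f' := deriv h) (C := M / ρ₁)
    (fun μ hμ => by
      obtain ⟨x, hx, rfl⟩ := hseg μ hμ
      exact (hder x hx).1.hasDerivWithinAt)
    (fun μ hμ => by
      obtain ⟨x, hx, rfl⟩ := hseg μ hμ
      exact (hder x hx).2)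
    (left_mem_segment ℝ (0 : ℂ) 1) (right_mem_segment ℝ (0 : ℂ) 1)
  have h1 : h 1 = H Z := by
    simp only [hh, hD, one_smul, add_sub_cancel]
  have h0 : h 0 = H Z' := by
    simp only [hh, zero_smul, add_zero]
  have hC : M / ρ₁ = 2 * M / (R - ρ₀) * ‖D‖ := by
    rw [hρ₁]; field_simp
  rw [h1, h0, sub_zero, norm_one, mul_one, hC] at hMVT
  exact hMVT

end Lipschitz

/-! ## §3 The directional remainder is Lipschitz in the direction, with the gain kept -/

section Direction

variable {E : Type*} [NormedAddCommGroup E] [NormedSpace ℂ E] [CompleteSpace F]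

omit [CompleteSpace F] in
/-- The slice `τ ↦ H(τ•B)` along a direction of norm `≤ a` (`0 < a`) is analytic on `|τ| < R′∕a` when `H` is analytic on
`‖z‖ < R`, `R′ ≤ R`. [folklore] -/
theorem differentiableOn_slice_of_norm_le {H : E → F} {R R' a : ℝ} (hH : DifferentiableOn ℂ H (ball 0 R)) (ha : 0 < a)
    (hR'R : R' ≤ R) {B : E} (hB : ‖B‖ ≤ a) :
    DifferentiableOn ℂ (fun τ : ℂ => H (τ • B)) (ball 0 (R' / a)) := by
  refine hH.comp (differentiableOn_id.smul_const B) fun τ hτ => ?_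
  rw [mem_ball_zero_iff] at hτ ⊢
  calc ‖τ • B‖ = ‖τ‖ * ‖B‖ := norm_smul _ _
    _ ≤ ‖τ‖ * a := mul_le_mul_of_nonneg_left hB (norm_nonneg τ)
    _ < R' / a * a := mul_lt_mul_of_pos_right hτ ha
    _ = R' := div_mul_cancel₀ R' ha.ne'
    _ ≤ R := hR'R

/-- **THE DIRECTIONAL REMAINDER IS LIPSCHITZ IN THE DIRECTION WITH THE GAIN KEPT (kernel; the theorem of this leaf).**  `H`
analytic on `‖z‖ < R` with `‖H‖ ≤ M` there; two directions with `‖A‖, ‖A′‖ ≤ a`, `0 < a < R′ < R`.  Then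
`‖dirRem H n A − dirRem H n A′‖ ≤ 2ⁿ·(2M∕(R − R′)·(R′∕a)·‖A − A′‖)·(a∕R′)ⁿ` (= `2^{n+1}·M·(a∕R′)^{n−1}·‖A − A′‖∕(R − R′)` for `n ≥ 1`):
the remainder is additive in the slice (§1), the difference slice `τ ↦ H(τ•A) − H(τ•A′)` is analytic on `|τ| < R′∕a` with sup
`≤ 2M∕(R − R′)·(R′∕a)·‖A − A′‖` there (§2 on the ball of radius `R′`), and the owner's `norm_taylorRem_le` applies to it at `τ = 1`.
In print's letters (`M ↔ E₀e^{−κd_j(X)}`, `a∕R′ ↔ (α₁∕α₃)L^jη`, `‖A − A′‖ ↔ |s − s′|·(size of ∂_s of the shift direction)`): the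
response of the fifth-order piece to the coupling keeps four powers of `L^jη` from the remainder and one from the direction
difference. [cite: Balaban1987RG1, (3.54) p.280; Balaban1988RG2Cluster, (1.21)-(1.24) p.7] -/
theorem norm_dirRem_sub_dirRem_le {H : E → F} {R R' M a : ℝ} {n : ℕ} (hH : DifferentiableOn ℂ H (ball 0 R))
    (hM : ∀ z ∈ ball (0 : E) R, ‖H z‖ ≤ M) (ha : 0 < a) (haR' : a < R') (hR'R : R' < R) {A A' : E}
    (hA : ‖A‖ ≤ a) (hA' : ‖A'‖ ≤ a) :
    ‖dirRem H n A - dirRem H n A'‖ ≤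
      2 ^ n * (2 * M / (R - R') * (R' / a) * ‖A - A'‖) * (a / R') ^ n := by
  have hR' : 0 < R' := ha.trans haR'
  have hr : 0 < R' / a := div_pos hR' ha
  have hdA := differentiableOn_slice_of_norm_le hH ha hR'R.le hA
  have hdA' := differentiableOn_slice_of_norm_le hH ha hR'R.le hA'
  -- the difference slice and its sup bound on the disc |τ| < R′/a
  have hsup : ∀ τ ∈ ball (0 : ℂ) (R' / a),
      ‖((fun τ : ℂ => H (τ • A)) - fun τ : ℂ => H (τ • A')) τ‖ ≤ 2 * M / (R - R') * (R' / a) * ‖A - A'‖ := by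
    intro τ hτ
    rw [mem_ball_zero_iff] at hτ
    have hτa : ‖τ‖ * a ≤ R' := by
      have := (mul_lt_mul_of_pos_right hτ ha).le
      rwa [div_mul_cancel₀ R' ha.ne'] at this
    have hZ : ‖τ • A‖ ≤ R' := by
      rw [norm_smul]; exact (mul_le_mul_of_nonneg_left hA (norm_nonneg τ)).trans hτa
    have hZ' : ‖τ • A'‖ ≤ R' := by
      rw [norm_smul]; exact (mul_le_mul_of_nonneg_left hA' (norm_nonneg τ)).trans hτa
    have h := norm_sub_le_of_ball hH hM hR'R hZ hZ'
    have hM0 : 0 ≤ M := by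
      have hR : 0 < R := hR'.trans hR'R
      exact (norm_nonneg _).trans (hM 0 (mem_ball_self hR))
    have hcoef : 0 ≤ 2 * M / (R - R') := div_nonneg (by positivity) (sub_pos.mpr hR'R).le
    rw [Pi.sub_apply]
    calc ‖H (τ • A) - H (τ • A')‖ ≤ 2 * M / (R - R') * ‖τ • A - τ • A'‖ := h
      _ = 2 * M / (R - R') * (‖τ‖ * ‖A - A'‖) := by rw [← smul_sub, norm_smul]
      _ ≤ 2 * M / (R - R') * (R' / a * ‖A - A'‖) := by
          refine mul_le_mul_of_nonneg_left (mul_le_mul_of_nonneg_right hτ.le (norm_nonneg _)) hcoef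
      _ = 2 * M / (R - R') * (R' / a) * ‖A - A'‖ := by ring
  have h1 : (1 : ℂ) ∈ ball (0 : ℂ) (R' / a) := by
    rw [mem_ball_zero_iff, norm_one, lt_div_iff₀ ha, one_mul]; exact haR'
  have hrem := norm_taylorRem_le (n := n) (hdA.sub hdA') hsup h1
  unfold dirRem
  rw [← taylorRem_sub hr hdA hdA' n 1]
  refine hrem.trans (le_of_eq ?_)
  rw [norm_one, one_div_div]

/-- The printed case `n = 5` with the letters collected: `‖dirRem H 5 A − dirRem H 5 A′‖ ≤ 64·M·(a∕R′)⁴·‖A − A′‖∕(R − R′)`.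
[cite: Balaban1987RG1, (3.54) p.280] -/
theorem norm_dirRem_sub_dirRem_five_le {H : E → F} {R R' M a : ℝ} (hH : DifferentiableOn ℂ H (ball 0 R))
    (hM : ∀ z ∈ ball (0 : E) R, ‖H z‖ ≤ M) (ha : 0 < a) (haR' : a < R') (hR'R : R' < R) {A A' : E}
    (hA : ‖A‖ ≤ a) (hA' : ‖A'‖ ≤ a) :
    ‖dirRem H 5 A - dirRem H 5 A'‖ ≤ 64 * M * (a / R') ^ 4 * ‖A - A'‖ / (R - R') := by
  have h := norm_dirRem_sub_dirRem_le (n := 5) hH hM ha haR' hR'R hA hA'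
  have hR' : 0 < R' := ha.trans haR'
  refine h.trans (le_of_eq ?_)
  field_simp
  ring

end Direction

/-! ## §4 The (1.23)-functional of the remainder DIFFERENCE: `bound_124` with its hypothesis discharged by §3 -/

section Piece

variable {E : Type*} [NormedAddCommGroup E] [NormedSpace ℂ E] [CompleteSpace F] {ι : Type*} [DecidableEq ι]

/-- **THE PER-PIECE COUPLING-RESPONSE BOUND FOR THE DISPLAYED SPECIES AT FORM LEVEL (kernel).**  With `ρ = e^{κ₁}`, `κ₁ ≥ 1`, the
t_□-radius `r > 0`, an old term `H` analytic on the ball of radius `R` and bounded by `M` there, two contour DIRECTION MAPS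
`A`, `A′` (↔ the shift at two couplings `s`, `s′`) of norm `≤ a` on the contours, `0 < a < R′ < R`, differing by at most `δ`
on the contours (↔ `a₁·|s − s′|`, the shift's Lipschitz modulus in the amplitude — TYPE (1.21), displayed): the (1.23)-functional
of the remainder DIFFERENCE is bounded by `(1∕r)·(2ⁿ·(2M∕(R − R′)·(R′∕a)·δ)·(a∕R′)ⁿ)·exp(−(κ₁ − 1)·#cubes)` —
`B13Sect1Arith.bound_124` with `hS'` discharged by `norm_dirRem_sub_dirRem_le`.  When the contour integrals of the two
remainders are integrable this functional IS `remPiece ρ r l H n A s σ − remPiece ρ r l H n A′ s σ` (linearity of the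
integral; instantiation-side, not asserted here), i.e. the displayed binder `hresp` of
`NE9PieceCouplingModulus.channelCouplingModulus_piece` for this species. [cite: Balaban1988RG2Cluster, (1.23)-(1.24) p.7] -/
theorem norm_remPieceDiff_le {κ₁ r R R' M a δ : ℝ} {n : ℕ} (hκ : 1 ≤ κ₁) (hr : 0 < r) {H : E → F}
    (hH : DifferentiableOn ℂ H (ball 0 R)) (hM : ∀ z ∈ ball (0 : E) R, ‖H z‖ ≤ M) (ha : 0 < a) (haR' : a < R')
    (hR'R : R' < R) (hδ : 0 ≤ δ) (l : List ι) (A A' : ℂ → (ι → ℝ) → (ι → ℂ) → E)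
    (hA : ∀ t ∈ Metric.sphere (0 : ℂ) r, ∀ s σ,
      (∀ i ∈ l, s i ∈ Set.Icc (0 : ℝ) 1 ∧ σ i ∈ Metric.sphere (0 : ℂ) (Real.exp κ₁)) → ‖A t s σ‖ ≤ a)
    (hA' : ∀ t ∈ Metric.sphere (0 : ℂ) r, ∀ s σ,
      (∀ i ∈ l, s i ∈ Set.Icc (0 : ℝ) 1 ∧ σ i ∈ Metric.sphere (0 : ℂ) (Real.exp κ₁)) → ‖A' t s σ‖ ≤ a)
    (hAA' : ∀ t ∈ Metric.sphere (0 : ℂ) r, ∀ s σ,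
      (∀ i ∈ l, s i ∈ Set.Icc (0 : ℝ) 1 ∧ σ i ∈ Metric.sphere (0 : ℂ) (Real.exp κ₁)) → ‖A t s σ - A' t s σ‖ ≤ δ)
    (s : ι → ℝ) (σ : ι → ℂ) (hsσ : ∀ i ∈ l, s i ∈ Set.Icc (0 : ℝ) 1 ∧ σ i ∈ Metric.sphere (0 : ℂ) (Real.exp κ₁)) :
    ‖(2 * Real.pi * I : ℂ)⁻¹ • ∮ t in C(0, r), (t ^ 2)⁻¹ •
        B13Sect1Arith.cauchyOp (Real.exp κ₁) l
          (fun s' σ' => dirRem H n (A t s' σ') - dirRem H n (A' t s' σ')) s σ‖ ≤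
      (1 / r) * (2 ^ n * (2 * M / (R - R') * (R' / a) * δ) * (a / R') ^ n) * Real.exp (-(κ₁ - 1) * l.length) := by
  have hR' : 0 < R' := ha.trans haR'
  have hM0 : 0 ≤ M := (norm_nonneg _).trans (hM 0 (mem_ball_self (hR'.trans hR'R)))
  have hcoef : 0 ≤ 2 * M / (R - R') * (R' / a) := by
    have := sub_pos.mpr hR'R
    positivity
  -- the bound on the contours, from §3 and monotonicity in ‖A − A′‖
  have hS' : ∀ t ∈ Metric.sphere (0 : ℂ) r, ∀ s σ,
      (∀ i ∈ l, s i ∈ Set.Icc (0 : ℝ) 1 ∧ σ i ∈ Metric.sphere (0 : ℂ) (Real.exp κ₁)) →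
        ‖dirRem H n (A t s σ) - dirRem H n (A' t s σ)‖ ≤ 2 ^ n * (2 * M / (R - R') * (R' / a) * δ) * (a / R') ^ n := by
    intro t ht s σ hsσ
    refine (norm_dirRem_sub_dirRem_le hH hM ha haR' hR'R (hA t ht s σ hsσ) (hA' t ht s σ hsσ)).trans ?_
    have hpow : 0 ≤ (a / R') ^ n := pow_nonneg (div_nonneg ha.le hR'.le) n
    have hmid : 2 * M / (R - R') * (R' / a) * ‖A t s σ - A' t s σ‖ ≤ 2 * M / (R - R') * (R' / a) * δ :=
      mul_le_mul_of_nonneg_left (hAA' t ht s σ hsσ) hcoef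
    exact mul_le_mul_of_nonneg_right (mul_le_mul_of_nonneg_left hmid (pow_nonneg (by norm_num) n)) hpow
  have hS0 : 0 ≤ 2 ^ n * (2 * M / (R - R') * (R' / a) * δ) * (a / R') ^ n := by
    have := sub_pos.mpr hR'R
    positivity
  exact B13Sect1Arith.bound_124 hκ hr hS0 l (fun t s' σ' => dirRem H n (A t s' σ') - dirRem H n (A' t s' σ')) hS' s σ hsσ

end Piece

end Summit.QuantumFields.BalabanUV.T4Continuum.NE9RemainderPieceCoupling

end
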